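import Summits.Ventures.LatticeQCDFlow.Scaling.TaggedStartContentDeficitGlobal
import Summits.Ventures.LatticeQCDFlow.Scaling.TaggedCostSideDeepTwo
import Summits.Ventures.LatticeQCDFlow.Scaling.StarOccupationComparison
import Summits.Ventures.LatticeQCDFlow.Scaling.TaggedDomination

/-!
HONEST FRAMING: exact (Metropolis-corrected) sampling algorithms for lattice gauge theory; figures
of merit are autocorrelation/cost numbers at stated couplings and volumes; no continuum-physics
claim.

# TaggedPerAttemptCertificateGlobal — CONJECTURE W′ (THE `σ`-WEIGHTED PER-ATTEMPT CERTIFICATE) ON EVERY ADJACENT EDGE IN THE DEEP CONFIGURATION, EVERY `K ≥ 2` — PRESENT CONTENTS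
# STRICTLY BETWEEN THE TWO EXTRA PARTICLES ALLOWED: `L·(x̃(★) + (x̃(a) − ỹ(a)) − D_J) ≥ cost(x̃) + cost(ỹ)` FOR EVERY TRUNCATION `J` (lean-2 GEN-42, ours)

Venture-side (OURS).  Cell `lqcd-flow` (pub-lqcd), unit `pub-lqcd-lean-2-g42`, 2026-08-30.  Chapter AB (route (β), the cost side continued), file 6 — the assembly on GLOBAL edges.
GEN-41 §0(a) showed that the cost side is needed on ALL adjacent edges, not only on depth-adjacent ones (the depth-adjacent class is not closed under the per-`j` coupling); file 5 of
this chapter removed the depth-adjacency proviso from the sharp start-content budget; the incomes never used it (W21 `S2_of_star_domination`, W26 `tagged_hub_domination`,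
W14's ★-certificate slack).  For the tagged chains of W14∕W26 from an ordinary hub `z` with `W_z ≤ W_b ≤ W_a`, `W_z < W_a`, three particles at or above `z` (`N_C(z) ≥ 2` or another
present content at or above `W_z`, ties included), ANY present contents between `W_b` and `W_a`, every `K ≥ 2`, no presence proviso:

* **`tagged_costSide_global`**: `L·D_J ≤ 2·s1` (`K = 2`: file 1's second-step income; `K ≥ 3`: GEN-41 file 7's hub slack; budget: file 5).
* **`tagged_perAttempt_certificate_global`**: `cost(x̃) + cost(ỹ) ≤ L·(x̃(★) + (x̃(a) − ỹ(a)) − D_J)` for every `J`, `L = 2K + M_X + M_Y` (GEN-41 file 4's decomposition + W21 + W26 +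
  the cost side above).

What remains for OPEN-MATH (b′) after this file: the residual pair (hub alone, everything else strictly below it) and hubs at or above `W_a` — files 7b, 10 — and hubs strictly
between `W_b` and `W_a` (memo MEMO-gen42).
Literature grade (cell rule): OWN; nothing cited; no new bib keys.
-/

open Finset

namespace Summit.Ventures.LatticeQCDFlow.Scaling

section CostSideGlobal
variable {S : Type*} [Fintype S] [DecidableEq S]
variable {W θ : S → ℝ} {acc : S → S → ℝ} {p : ℝ} {K : ℕ} {NC : S → ℕ} {a b : S} {PX PY : Option S → Option S → ℝ}

/-- **THE COST-SIDE INEQUALITY ON AN ARBITRARY ADJACENT EDGE, DEEP CONFIGURATION, EVERY `K ≥ 2`:** `L·Σ_{n<J}(1−σ)σⁿ(y_{n+1}(z) − x_{n+1}(z))⁺ ≤ 2·s1` (present contents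
strictly between the extra particles allowed). [ours] -/
theorem tagged_costSide_global (hW : ∀ v, 0 < W v) (hp0 : 0 ≤ p) (hp : ∀ v, p * W v ≤ 1) (hθ : ∀ v, θ v = 1 / (1 + p * W v))
    (hacc : ∀ h v, acc h v = min 1 (W h / W v)) (hK : 2 ≤ K) (hNC : ∑ v, NC v = K) (hab : W b ≤ W a)
    (hPXoff : ∀ h v, h ≠ v → PX (some h) (some v) = if NC h = 0 then 0 else (NC v : ℝ) / K * acc h v)
    (hPXin : ∀ h, PX (some h) none = if NC h = 0 then 0 else acc h a / K)
    (hPXdiag : ∀ h, PX (some h) (some h) = 1 - (∑ v ∈ univ.erase h, PX (some h) (some v) + PX (some h) none))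
    (hPXout : ∀ v, PX none (some v) = (NC v : ℝ) / K * acc a v) (hPXstay : PX none none = 1 - ∑ v, PX none (some v))
    (hPYoff : ∀ h v, h ≠ v → PY (some h) (some v) = if NC h = 0 then 0 else (NC v : ℝ) / K * acc h v)
    (hPYin : ∀ h, PY (some h) none = if NC h = 0 then 0 else acc h b / K)
    (hPYdiag : ∀ h, PY (some h) (some h) = 1 - (∑ v ∈ univ.erase h, PY (some h) (some v) + PY (some h) none))
    (hPYout : ∀ v, PY none (some v) = (NC v : ℝ) / K * acc b v) (hPYstay : PY none none = 1 - ∑ v, PY none (some v))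
    {z : S} (hz : NC z ≠ 0) (hzb : W z ≤ W b) (hza : W z < W a) (hthree : 2 ≤ NC z ∨ ∃ w, w ≠ z ∧ NC w ≠ 0 ∧ W z ≤ W w)
    {x y : ℕ → Option S → ℝ}
    (hx0 : ∀ v, x 0 v = if v = some z then 1 else 0) (hxs : ∀ n v, x (n + 1) v = ∑ h, x n h * PX h v)
    (hy0 : ∀ v, y 0 v = if v = some z then 1 else 0) (hys : ∀ n v, y (n + 1) v = ∑ h, y n h * PY h v)
    {M : ℝ} (hM : M = ∑ v, θ v * (NC v : ℝ) + θ a) {L : ℝ} (hL0 : 0 ≤ L) (hL4 : L ≤ 4 * K + 2)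
    {σ : ℝ} (hσ0 : 0 ≤ σ) (hσ1 : σ < 1) {ut : Option S → ℝ} (hut : ∀ t, ut t = (1 - σ) * PX (some z) t + σ * ∑ t', ut t' * PX t' t) (J : ℕ) :
    L * ∑ n ∈ range J, (1 - σ) * σ ^ n * max 0 (y (n + 1) (some z) - x (n + 1) (some z))
      ≤ 2 * ((K + M) * ut none - (∑ v, ut (some v) * (1 - θ v) + ut none * (1 - θ a))) := by
  have hK1 : 1 ≤ K := by omega
  have hK0 : (0 : ℝ) < K := by exact_mod_cast (show 0 < K by omega)
  have hθm := theta_mem hW hp0 hp hθ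
  -- the deficit budget (file 5: no depth-adjacency proviso)
  obtain ⟨-, hD⟩ := tagged_startClass_deficit_global hW hacc hK hNC hab hPXoff hPXin hPXdiag hPXout hPXstay hPYoff hPYin hPYdiag hPYout hPYstay hz hzb hza hthree hx0 hxs hy0 hys
  have hDJ := hD σ hσ0 hσ1.le J
  -- the certificate slack (GEN-41 file 4)
  obtain ⟨r, hr⟩ : ∃ r : Option S → ℝ, ∀ t, r t = Option.elim t ((K + M) - (1 - θ a)) (fun v => -(1 - θ v)) := ⟨_, fun _ => rfl⟩
  obtain ⟨Λ, hΛ⟩ : ∃ Λ : Option S → ℝ, ∀ t, Λ t = Option.elim t (-(1 - θ a)) (fun _ => 0) := ⟨_, fun _ => rfl⟩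
  obtain ⟨sl, hsl⟩ : ∃ sl : Option S → ℝ, ∀ t, sl t = ∑ t', PX t t' * (r t' + Λ t') - Λ t := ⟨_, fun _ => rfl⟩
  have hrn : r none = (K + M) - (1 - θ a) := by rw [hr]; rfl
  have hrs : ∀ v, r (some v) = -(1 - θ v) := fun v => by rw [hr]; rfl
  have hΛn : Λ none = -(1 - θ a) := by rw [hΛ]; rfl
  have hΛs : ∀ v, Λ (some v) = 0 := fun v => by rw [hΛ]; rfl
  have heq := ledger_tail_eq hsl hut
  have hP0 := tagged_nonneg hW hacc hPXoff hPXin hPXdiag hPXout hPXstay hK1 hNC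
  have hP1 := tagged_rowsum (P := PX) hPXdiag hPXstay
  have hut0 : ∀ t, 0 ≤ ut t := geomResolvent_nonneg hP0 hP1 hσ0 hσ1 (ν := fun t => PX (some z) t) (fun t => hP0 _ _) hut
  have hsl_none : 0 ≤ sl none := by
    rw [hsl]; linarith only [tagged_supersolution_none hW hp0 hp hθ hacc hPXout hPXstay hK1 hNC hM hrn hrs hΛn hΛs]
  have hsl_some : ∀ v, NC v ≠ 0 → 0 ≤ sl (some v) := fun v hv => by
    rw [hsl]; linarith only [tagged_supersolution_some hW hp0 hp hθ hacc hPXoff hPXin hPXdiag hK1 hNC hM hrn hrs hΛn hΛs hv]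
  have habs : ∀ w, NC w = 0 → ut (some w) = 0 := fun w hw =>
    tagged_tail_absent hW hacc hPXoff hPXin hPXdiag hPXout hPXstay hK1 hNC hσ0 hσ1 hz hut hw
  have hΛz : Λ (some z) = 0 := hΛs z
  have hEΛ : ∑ t, ut t * Λ t = -(1 - θ a) * ut none := by rw [tagged_sum_option, hΛn]; simp [hΛs]; ring
  have hEr : ∑ t, ut t * r t = (K + M) * ut none - (∑ v, ut (some v) * (1 - θ v) + ut none * (1 - θ a)) := by
    rw [tagged_sum_option, hrn]; simp only [hrs]
    have e : ∑ v, ut (some v) * -(1 - θ v) = -∑ v, ut (some v) * (1 - θ v) := by rw [← sum_neg_distrib]; exact sum_congr rfl fun v _ => by ring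
    rw [e]; ring
  -- `s1 = (1−σ)sl(z) + σE_ũ[sl] + (1−σ)(1−θ_a)ũ(★)` (exact)
  have hs1eq : (K + M) * ut none - (∑ v, ut (some v) * (1 - θ v) + ut none * (1 - θ a))
      = (1 - σ) * sl (some z) + σ * ∑ t, ut t * sl t + (1 - σ) * ((1 - θ a) * ut none) := by
    rw [← hEr, heq, hΛz, hEΛ]; ring
  have htail0 : 0 ≤ (1 - σ) * ((1 - θ a) * ut none) :=
    mul_nonneg (by linarith only [hσ1]) (mul_nonneg (by linarith only [(hθm a).2]) (hut0 none))
  -- the kernel data at the hub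
  set γ := PX (some z) (some z) - PY (some z) (some z) with hγdef
  set q := max 0 ((NC z : ℝ) / K - PX (some z) (some z)) with hqdef
  have hγeq : γ = (acc z b - acc z a) / K := costSide_gamma_eq hPXoff hPXin hPXdiag hPYoff hPYin hPYdiag hz
  obtain ⟨hγ0, hγle⟩ := costSide_gamma_le hW hacc hab hK1 z
  rw [← hγeq] at hγ0 hγle
  have hq0 : 0 ≤ q := le_max_left _ _
  have hqle : q ≤ acc z a / K := max_le (div_nonneg (starHub_acc_nonneg hW hacc z a) hK0.le) (costSide_q_le hacc hK1 hNC hPXoff hPXin hPXdiag hz)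
  have hα0 : 0 ≤ acc z a := starHub_acc_nonneg hW hacc z a
  have hα1 : acc z a ≤ 1 := by rw [hacc]; exact min_le_left _ _
  -- no deficit budget unless the holding probability at the hub is below `N_C(z)/K`
  have hD0 : 0 ≤ ∑ n ∈ range J, (1 - σ) * σ ^ n * max 0 (y (n + 1) (some z) - x (n + 1) (some z)) :=
    sum_nonneg fun n _ => mul_nonneg (mul_nonneg (by linarith) (pow_nonneg hσ0 n)) (le_max_left _ _)
  have hE0 : 0 ≤ ∑ t, ut t * sl t := by
    rw [tagged_sum_option]
    refine add_nonneg (mul_nonneg (hut0 none) hsl_none) (sum_nonneg fun v _ => ?_)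
    by_cases hv : NC v = 0
    · rw [habs v hv, zero_mul]
    · exact mul_nonneg (hut0 _) (hsl_some v hv)
  have hs10 : 0 ≤ (K + M) * ut none - (∑ v, ut (some v) * (1 - θ v) + ut none * (1 - θ a)) := by
    rw [hs1eq]
    have h1 := mul_nonneg (by linarith only [hσ1] : (0:ℝ) ≤ 1 - σ) (hsl_some z hz)
    have h2 := mul_nonneg hσ0 hE0
    linarith only [h1, h2, htail0]
  by_cases hq : q = 0
  · have hle0 : ∑ n ∈ range J, (1 - σ) * σ ^ n * max 0 (y (n + 1) (some z) - x (n + 1) (some z)) ≤ 0 := by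
      refine hDJ.trans ?_
      rw [hq]; simp
    have hD00 : ∑ n ∈ range J, (1 - σ) * σ ^ n * max 0 (y (n + 1) (some z) - x (n + 1) (some z)) = 0 := le_antisymm hle0 hD0
    rw [hD00, mul_zero]; linarith only [hs10]
  -- `q > 0`: the holding probability at `z` is below `N_C(z)/K`
  have hhold : PX (some z) (some z) ≤ (NC z : ℝ) / K := by
    by_contra hcon
    have h' : (NC z : ℝ) / K - PX (some z) (some z) ≤ 0 := by linarith only [not_le.mp hcon]
    exact hq (le_antisymm (max_le le_rfl h') hq0)
  rcases Nat.eq_or_lt_of_le hK with hK2 | hK3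
  · -- `K = 2`: the second step's income (file 1's mechanism)
    have hKe : K = 2 := hK2.symm
    have hKr : (K : ℝ) = 2 := by exact_mod_cast hKe
    have hNC2 : ∑ v, NC v = 2 := by rw [hNC, hKe]
    have hL10 : L ≤ 10 := by linarith only [hL4, hKr]
    -- the slack is at least `c = acc(z,a)·3θ_a/2` at EVERY present content
    set c := acc z a * (3 * θ a) / 2 with hcdef
    have hc0 : 0 ≤ c := by rw [hcdef]; have := (hθm a).1; positivity
    have hcK : ∀ v, acc v a * ((K : ℝ) - 2 + 3 * θ a) / K = acc v a * (3 * θ a) / 2 := fun v => by rw [hKr]; ring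
    have hslack_all : ∀ v, NC v ≠ 0 → c ≤ sl (some v) := by
      intro v hv
      by_cases hvz : v = z
      · subst hvz
        have h := costSide_slack_ge hW hp0 hp hθ hacc hPXoff hPXin hK1 hM hrn hrs hΛn hΛs hsl hv hhold
        rwa [hcK] at h
      · -- one particle at `z`, one at `v`, `W_z < W_v`
        obtain ⟨hz1, hv1, hothers⟩ := costSide_two_particles hNC2 hz hv hvz
        have hzv : W z ≤ W v := by
          rcases hthree with h2 | ⟨w, hwz, hw, hzw⟩
          · omega
          · by_cases hwv : w = v
            · rwa [hwv] at hzw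
            · exact absurd (hothers w hwz hwv) hw
        have hholdv := costSide_hold_of_deeper hW hacc hPXoff hPXin hPXdiag hKe hvz hz1 hv1 hzv
        have h := costSide_slack_ge hW hp0 hp hθ hacc hPXoff hPXin hK1 hM hrn hrs hΛn hΛs hsl hv hholdv
        rw [hcK] at h
        have hmono : acc z a * (3 * θ a) / 2 ≤ acc v a * (3 * θ a) / 2 :=
          div_le_div_of_nonneg_right (mul_le_mul_of_nonneg_right (costSide_acc_mono hW hacc hzv a) (by linarith only [(hθm a).1])) (by norm_num)
        exact hmono.trans h
    -- the second step's income
    have hE := costSide_secondStep_ge hP0 hP1 hPXoff hz hσ0 hut hut0 habs hsl_none hc0 hslack_all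
    have hPzn : PX (some z) none = acc z a / 2 := by rw [hPXin, if_neg hz, hKr]
    rw [hPzn] at hE
    -- `s1 ≥ (1−σ)·c·(1 + σ(1 − acc(z,a)/2))`
    have hs1 : (1 - σ) * (c * (1 + σ * (1 - acc z a / 2))) ≤ (K + M) * ut none - (∑ v, ut (some v) * (1 - θ v) + ut none * (1 - θ a)) := by
      rw [hs1eq]
      have h1 : (1 - σ) * c ≤ (1 - σ) * sl (some z) := mul_le_mul_of_nonneg_left (hslack_all z hz) (by linarith only [hσ1])
      have h2 : σ * ((1 - σ) * (c * (1 - acc z a / 2))) ≤ σ * ∑ t, ut t * sl t := mul_le_mul_of_nonneg_left hE hσ0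
      have e : (1 - σ) * (c * (1 + σ * (1 - acc z a / 2))) = (1 - σ) * c + σ * ((1 - σ) * (c * (1 - acc z a / 2))) := by ring
      rw [e]; linarith only [h1, h2, htail0]
    -- the scalar inequality
    have hq2 : q ≤ acc z a / 2 := by rwa [hKr] at hqle
    have hγ2 : γ ≤ (1 - acc z a) / 2 := by rwa [hKr] at hγle
    have hscal := costSide_scalar_two hL10 hα0 hα1 (hθm a).1 hγ0 hγ2 hq0 hq2 hσ0 hσ1.le
    -- chain
    calc L * ∑ n ∈ range J, (1 - σ) * σ ^ n * max 0 (y (n + 1) (some z) - x (n + 1) (some z))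
        ≤ L * ((1 - σ) * (γ * (σ * q / (1 - (σ * q) ^ 2)))) := mul_le_mul_of_nonneg_left hDJ hL0
      _ = (1 - σ) * (L * (γ * (σ * q / (1 - (σ * q) ^ 2)))) := by ring
      _ ≤ (1 - σ) * (2 * (c * (1 + σ * (1 - acc z a / 2)))) := by
          apply mul_le_mul_of_nonneg_left _ (by linarith only [hσ1])
          rw [hcdef]; exact hscal
      _ = 2 * ((1 - σ) * (c * (1 + σ * (1 - acc z a / 2)))) := by ring
      _ ≤ 2 * ((K + M) * ut none - (∑ v, ut (some v) * (1 - θ v) + ut none * (1 - θ a))) := mul_le_mul_of_nonneg_left hs1 (by norm_num)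

  · -- `K ≥ 3`: the first step's income (GEN-41 file 7's mechanism)
    have hK3r : (3 : ℝ) ≤ K := by exact_mod_cast hK3
    have hslack := costSide_slack_ge hW hp0 hp hθ hacc hPXoff hPXin hK1 hM hrn hrs hΛn hΛs hsl hz hhold
    have hscal := costSide_scalar hK3r hL4 hα0 hα1 (hθm a).1 hγ0 hγle hq0 hqle hσ0 hσ1.le
    have hs1' : (1 - σ) * sl (some z) ≤ (K + M) * ut none - (∑ v, ut (some v) * (1 - θ v) + ut none * (1 - θ a)) := by
      rw [hs1eq]
      have h2 := mul_nonneg hσ0 hE0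
      linarith only [h2, htail0]
    calc L * ∑ n ∈ range J, (1 - σ) * σ ^ n * max 0 (y (n + 1) (some z) - x (n + 1) (some z))
        ≤ L * ((1 - σ) * (γ * (σ * q / (1 - (σ * q) ^ 2)))) := mul_le_mul_of_nonneg_left hDJ hL0
      _ = (1 - σ) * (L * (γ * (σ * q / (1 - (σ * q) ^ 2)))) := by ring
      _ ≤ (1 - σ) * (2 * (acc z a * ((K : ℝ) - 2 + 3 * θ a) / K)) := mul_le_mul_of_nonneg_left hscal (by linarith only [hσ1])
      _ ≤ (1 - σ) * (2 * sl (some z)) := mul_le_mul_of_nonneg_left (by linarith only [hslack]) (by linarith only [hσ1])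
      _ = 2 * ((1 - σ) * sl (some z)) := by ring
      _ ≤ 2 * ((K + M) * ut none - (∑ v, ut (some v) * (1 - θ v) + ut none * (1 - θ a))) := mul_le_mul_of_nonneg_left hs1' (by norm_num)

/-- **CONJECTURE W′ ON AN ARBITRARY ADJACENT EDGE, DEEP CONFIGURATION, EVERY `K ≥ 2`** (see the module docstring). [ours] -/
theorem tagged_perAttempt_certificate_global (hW : ∀ v, 0 < W v) (hp0 : 0 ≤ p) (hp : ∀ v, p * W v ≤ 1) (hθ : ∀ v, θ v = 1 / (1 + p * W v))
    (hacc : ∀ h v, acc h v = min 1 (W h / W v)) (hK : 2 ≤ K) (hNC : ∑ v, NC v = K) (hab : W b ≤ W a)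
    (hPXoff : ∀ h v, h ≠ v → PX (some h) (some v) = if NC h = 0 then 0 else (NC v : ℝ) / K * acc h v)
    (hPXin : ∀ h, PX (some h) none = if NC h = 0 then 0 else acc h a / K)
    (hPXdiag : ∀ h, PX (some h) (some h) = 1 - (∑ v ∈ univ.erase h, PX (some h) (some v) + PX (some h) none))
    (hPXout : ∀ v, PX none (some v) = (NC v : ℝ) / K * acc a v) (hPXstay : PX none none = 1 - ∑ v, PX none (some v))
    (hPYoff : ∀ h v, h ≠ v → PY (some h) (some v) = if NC h = 0 then 0 else (NC v : ℝ) / K * acc h v)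
    (hPYin : ∀ h, PY (some h) none = if NC h = 0 then 0 else acc h b / K)
    (hPYdiag : ∀ h, PY (some h) (some h) = 1 - (∑ v ∈ univ.erase h, PY (some h) (some v) + PY (some h) none))
    (hPYout : ∀ v, PY none (some v) = (NC v : ℝ) / K * acc b v) (hPYstay : PY none none = 1 - ∑ v, PY none (some v))
    {z : S} (hz : NC z ≠ 0) (hzb : W z ≤ W b) (hza : W z < W a) (hthree : 2 ≤ NC z ∨ ∃ w, w ≠ z ∧ NC w ≠ 0 ∧ W z ≤ W w)
    {x y : ℕ → Option S → ℝ}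
    (hx0 : ∀ v, x 0 v = if v = some z then 1 else 0) (hxs : ∀ n v, x (n + 1) v = ∑ h, x n h * PX h v)
    (hy0 : ∀ v, y 0 v = if v = some z then 1 else 0) (hys : ∀ n v, y (n + 1) v = ∑ h, y n h * PY h v)
    {M : ℝ} (hM : M = ∑ v, θ v * (NC v : ℝ) + θ a) {L : ℝ} (hL : L = 2 * K + M + (∑ v, θ v * (NC v : ℝ) + θ b))
    {σ : ℝ} (hσ0 : 0 ≤ σ) (hσ1 : σ < 1) {xt yt xs ys : Option S → ℝ}
    (hxt : ∀ t, xt t = (1 - σ) * PX (some z) t + σ * ∑ t', xt t' * PX t' t) (hyt : ∀ t, yt t = (1 - σ) * PY (some z) t + σ * ∑ t', yt t' * PY t' t)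
    (hxsr : ∀ t, xs t = (1 - σ) * PX none t + σ * ∑ t', xs t' * PX t' t) (hysr : ∀ t, ys t = (1 - σ) * PY none t + σ * ∑ t', ys t' * PY t' t) (J : ℕ) :
    (∑ v, xt (some v) * (1 - θ v) + xt none * (1 - θ a)) + (∑ v, yt (some v) * (1 - θ v) + yt none * (1 - θ b))
      ≤ L * (xt none + (xt (some a) - yt (some a)) - ∑ n ∈ range J, (1 - σ) * σ ^ n * max 0 (y (n + 1) (some z) - x (n + 1) (some z))) := by
  have hK1 : 1 ≤ K := by omega
  have hθm := theta_mem hW hp0 hp hθ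
  -- the exact decomposition (file 4)
  have hMY : (∑ v, θ v * (NC v : ℝ) + θ b) = M + (θ b - θ a) := by rw [hM]; ring
  have hdec := ledger_perStep_eq (θ := θ) (x := xt) (y := yt) (z := z) (a := a)
    (pen := ∑ n ∈ range J, (1 - σ) * σ ^ n * max 0 (y (n + 1) (some z) - x (n + 1) (some z))) hMY hL
  -- the incomes
  -- (i) `s3 ≥ 0`
  have hDstar := tagged_star_domination hW hacc hK1 hNC hab hPXoff hPXin hPXdiag hPXout hPXstay hPYoff hPYin hPYdiag hPYout hPYstay hσ0 hσ1 hxsr hysr z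
  have hs3 := S2_of_star_domination hW hp0 hp hθ hacc hK1 hNC hab hPXoff hPXin hPXdiag hPXout hPXstay hPYoff hPYin hPYout hσ0 hσ1 hz hxt hyt hxsr hysr hDstar
  -- (ii) domination from the hub at every ordinary content (W26), in particular at `a` and at `z`
  have hdom := tagged_hub_domination hW hacc hK1 hNC hab hPXoff hPXin hPXdiag hPXout hPXstay hPYoff hPYin hPYdiag hPYout hPYstay hσ0 hσ1 hz hxt hyt
  have hgap_a : 0 ≤ xt (some a) - yt (some a) := by linarith [hdom a]
  have hgaps : 0 ≤ ∑ v ∈ univ.erase z, (xt (some v) - yt (some v)) * (1 - θ v) :=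
    sum_nonneg fun v _ => mul_nonneg (by linarith [hdom v]) (by linarith [(hθm v).2])
  have hez : 0 ≤ -((1 - θ z) * (yt (some z) - xt (some z))) := by
    have h1 : 0 ≤ 1 - θ z := by linarith [(hθm z).2]
    have h2 : yt (some z) - xt (some z) ≤ 0 := by linarith [hdom z]
    nlinarith
  -- `0 ≤ L ≤ 4K + 2`
  have hMC : ∑ v, θ v * (NC v : ℝ) ≤ K := by
    calc ∑ v, θ v * (NC v : ℝ) ≤ ∑ v, (NC v : ℝ) := sum_le_sum fun v _ =>
            mul_le_of_le_one_left (Nat.cast_nonneg _) (hθm v).2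
      _ = K := by exact_mod_cast hNC
  have hMC0 : 0 ≤ ∑ v, θ v * (NC v : ℝ) := sum_nonneg fun v _ => mul_nonneg (by linarith [(hθm v).1]) (Nat.cast_nonneg _)
  have hK0 : (0 : ℝ) ≤ K := Nat.cast_nonneg _
  have hL0 : 0 ≤ L := by rw [hL, hM]; linarith only [hMC0, (hθm a).1, (hθm b).1, hK0]
  have hL4 : L ≤ 4 * K + 2 := by rw [hL, hM]; linarith only [hMC, (hθm a).2, (hθm b).2]
  -- (iii) the cost side (global)
  have hcost := tagged_costSide_global hW hp0 hp hθ hacc hK hNC hab hPXoff hPXin hPXdiag hPXout hPXstay hPYoff hPYin hPYdiag hPYout hPYstay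
    hz hzb hza hthree hx0 hxs hy0 hys hM hL0 hL4 hσ0 hσ1 hxt J
  -- assemble
  have key : 0 ≤ L * (xt none + (xt (some a) - yt (some a)) - ∑ n ∈ range J, (1 - σ) * σ ^ n * max 0 (y (n + 1) (some z) - x (n + 1) (some z)))
      - (∑ v, xt (some v) * (1 - θ v) + xt none * (1 - θ a)) - (∑ v, yt (some v) * (1 - θ v) + yt none * (1 - θ b)) := by
    rw [hdec]
    have hga : 0 ≤ L * (xt (some a) - yt (some a)) := mul_nonneg hL0 hgap_a
    nlinarith [hs3, hga, hgaps, hez, hcost]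
  linarith

end CostSideGlobal

end Summit.Ventures.LatticeQCDFlow.Scaling
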